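import Mathlib
import Literature.Probability.LatticeModels.GKSInequalities
import Summits.CriticalPhenomena.Ising3DConformalLimit.Theorems.PrecisionLaplacianInverseMFerromagnetTwoSumPrecision
import Summits.CriticalPhenomena.Ising3DConformalLimit.Theorems.PrecisionLaplacianInverseMFerromagnetTwoSepMarkov
import Summits.CriticalPhenomena.Ising3DConformalLimit.Theorems.PrecisionLaplacianInverseMFerromagnetGlueIneq
import Summits.CriticalPhenomena.Ising3DConformalLimit.Theorems.PrecisionLaplacianInverseMFerromagnetSpSubdivideAux3
import HarnessLib

/-!
# Crux `PrecisionLaplacian.InverseMFerromagnet` (stmt-CriticalPhenomena-4798), line `Sketch` —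
# stub `helper_sp_subdivide` (T-SP·3: the subdivision / series step of the series–parallel induction)

THEOREM-ONLY file (no definitions).  DB♯ — `(Σ⁻¹)_xy ≤ −t/(1 + t² − 2tG_xy)`, `t = tanh (total
coupling on {x,y})`, `G_xy = ⟨σ_xσ_y⟩` — for ALL nonnegative couplings on the structure
`(n, m, C)` implies DB♯ for all nonnegative couplings on the SUBDIVIDED structure: the bond
`i₀ = {a, b}` is replaced by the path `a' – ℓ – b'` (`ℓ = Fin.last n` the new site, old sites
embedded by `castSucc`; `C' i₀.castSucc = {a', ℓ}` with coupling `u`, `C' (Fin.last m) = {ℓ, b'}`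
with coupling `w`).

Proof.  `A` = old sites, `B = {a', b', ℓ}`, `S = {a', b'}`: every bond lies in `A` or in `B`, so
`Σ'⁻¹ = [Σ'_AA⁻¹]⁰ + [Σ'_BB⁻¹]⁰ − [Σ'_SS⁻¹]⁰` (`helper_twoSep_markov`, `helper_twoSum_precision`).
By the marginal identity (`spSub_marginal`: summing out `σ_ℓ` gives the old structure with the
series coupling `K'' = ½ log (cosh (u+w)/cosh (u−w)) ≥ 0` on `i₀`) `Σ'_AA` is the old second-moment
matrix at that coupling, to which the hypothesis applies (`spSub_Ablock`).  Cases (`x ≠ y`, and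
`Σ'⁻¹`, the bound are symmetric): (i) `x = ℓ`, `y ∉ {a', b'}`: the entry and the bound vanish;
(ii) `x = ℓ`, `y ∈ {a', b'}`: `ℓ` has degree two, `helper_db_deg2_eq` (equality); (iii) `x, y`
old, `{x,y} ≠ {a',b'}`: the entry is the old inverse entry, bounded by the hypothesis (same total
coupling, same correlation); (iv) `(x, y) = (a', b')`: `P + Q + ρ/(1−ρ²)` with
`P ≤ −f_ρ(tanh (K₁ + K''))` (hypothesis; `K₁` = total NEW coupling on `{a',b'}` = the old bonds
parallel to `i₀`), `Q = −f_ρ(tanh (K₁ + J))` and `ρ = tanh (K₁ + J + K'')` from the triangle system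
of `helper_marginal_twoSep` (ii) (`spSub_T_Q`, `spSub_T_rho`; `J = ½ log ((1+r)/(1−r)) ≥ 0`, `r`
the `a'b'`-correlation of the bonds outside `B`, `r ≥ 0` by GKS I), `[Σ'_SS⁻¹]_{a'b'} = −ρ/(1−ρ²)`
(`spSub_inv_two`); `helper_db_glue_ineq` with `k₀ = K₁`, `a = J`, `b = K''` is the claim.
-/

namespace Summit.CriticalPhenomena.Ising3DConformalLimit.Cruxes.InverseMFerromagnet.PartialCovarianceLadder

open Literature.Probability.LatticeModels Finset Matrix

noncomputable section

/-- **T-SP·3 (subdivision = series extension; the heart of T-SP).**  Replacing the bond `i₀ = {a, b}`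
by the path `a – last – b` (bond `i₀ ↦ {a, last}` with coupling `K' i₀`, new bond
`Fin.last m = {last, b}` with coupling `K' last`, both arbitrary ≥ 0) preserves DB♯ for all couplings:
2-sum decomposition across the separator `{a, b}`, the old block is the old structure with the series
coupling `K''` (hypothesis), the triangle block and the separator correlation are explicit
(degree-two equality, `tanh`-addition), and the separator pair is the glue inequality. [folklore] -/
theorem helper_sp_subdivide :
    ∀ (n m : ℕ) (C : Fin m → Finset (Fin n)), (∀ i, (C i).card = 2) →
    (∀ (K : Fin m → ℝ), (∀ i, 0 ≤ K i) → ∀ x y : Fin n, x ≠ y →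
        (Matrix.of fun p q : Fin n => gksExpect Finset.univ K C (fun ω => spinAt p ω * spinAt q ω))⁻¹ x y ≤
          -(Real.tanh (∑ i ∈ Finset.univ.filter (fun i => C i = {x, y}), K i)) /
            (1 + Real.tanh (∑ i ∈ Finset.univ.filter (fun i => C i = {x, y}), K i) ^ 2
              - 2 * Real.tanh (∑ i ∈ Finset.univ.filter (fun i => C i = {x, y}), K i)
                * gksExpect Finset.univ K C (fun ω => spinAt x ω * spinAt y ω))) →
    ∀ (i₀ : Fin m) (a b : Fin n), a ≠ b → C i₀ = {a, b} →
      ∀ (C' : Fin (m + 1) → Finset (Fin (n + 1))),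
        (∀ i : Fin m, i ≠ i₀ → C' i.castSucc = (C i).map Fin.castSuccEmb) →
        C' i₀.castSucc = {a.castSucc, Fin.last n} →
        C' (Fin.last m) = {Fin.last n, b.castSucc} →
        ∀ (K' : Fin (m + 1) → ℝ), (∀ i, 0 ≤ K' i) → ∀ x y : Fin (n + 1), x ≠ y →
        (Matrix.of fun p q : Fin (n + 1) => gksExpect Finset.univ K' C' (fun ω => spinAt p ω * spinAt q ω))⁻¹ x y ≤
          -(Real.tanh (∑ i ∈ Finset.univ.filter (fun i => C' i = {x, y}), K' i)) /
            (1 + Real.tanh (∑ i ∈ Finset.univ.filter (fun i => C' i = {x, y}), K' i) ^ 2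
              - 2 * Real.tanh (∑ i ∈ Finset.univ.filter (fun i => C' i = {x, y}), K' i)
                * gksExpect Finset.univ K' C' (fun ω => spinAt x ω * spinAt y ω)) := by
  intro n m C hC IH i₀ a b hab hCi₀ C' hC'1 hC'2 hC'3 K' hK'
  -- the structure
  have hC'card : ∀ j, (C' j).card = 2 := spSub_card C hC i₀ a b C' hC'1 hC'2 hC'3
  have hcases := spSub_bond_cases C i₀ a b C' hC'1 hC'2 hC'3
  have hab' : a.castSucc ≠ b.castSucc := fun h => hab (Fin.castSucc_injective _ h)
  have hal : a.castSucc ≠ Fin.last n := Fin.castSucc_ne_last a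
  have hbl : b.castSucc ≠ Fin.last n := Fin.castSucc_ne_last b
  set A : Finset (Fin (n + 1)) := Finset.univ.erase (Fin.last n) with hA
  have hsides : ∀ j, C' j ⊆ A ∨ C' j ⊆ insert a.castSucc (insert b.castSucc Aᶜ) :=
    spSub_sides C i₀ a b C' hC'1 hC'2 hC'3
  set B : Finset (Fin (n + 1)) := insert a.castSucc (insert b.castSucc Aᶜ) with hB
  have hmemA : ∀ z : Fin (n + 1), z ∈ A ↔ z ≠ Fin.last n := fun z => by simp [hA]
  have hmemB : ∀ z : Fin (n + 1), z ∈ B ↔ (z = a.castSucc ∨ z = b.castSucc ∨ z = Fin.last n) :=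
    fun z => by simp [hB, hA]
  have hmemS : ∀ z : Fin (n + 1), z ∈ ({a.castSucc, b.castSucc} : Finset (Fin (n + 1)))
      ↔ (z = a.castSucc ∨ z = b.castSucc) := fun z => by simp
  have haA : a.castSucc ∈ A := (hmemA _).2 hal
  have hbA : b.castSucc ∈ A := (hmemA _).2 hbl
  have hlA : Fin.last n ∉ A := fun h => (hmemA _).1 h rfl
  have haB : a.castSucc ∈ B := (hmemB _).2 (Or.inl rfl)
  have hbB : b.castSucc ∈ B := (hmemB _).2 (Or.inr (Or.inl rfl))
  have hlB : Fin.last n ∈ B := (hmemB _).2 (Or.inr (Or.inr rfl))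
  have haS : a.castSucc ∈ ({a.castSucc, b.castSucc} : Finset (Fin (n + 1))) := (hmemS _).2 (Or.inl rfl)
  have hbS : b.castSucc ∈ ({a.castSucc, b.castSucc} : Finset (Fin (n + 1))) := (hmemS _).2 (Or.inr rfl)
  -- the second-moment matrix of the subdivided system and its 2-sum decomposition
  set G : Matrix (Fin (n + 1)) (Fin (n + 1)) ℝ := Matrix.of fun p q : Fin (n + 1) =>
    gksExpect Finset.univ K' C' (fun ω => spinAt p ω * spinAt q ω) with hG
  have hGe : ∀ p q, gksExpect Finset.univ K' C' (fun ω => spinAt p ω * spinAt q ω) = G p q :=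
    fun p q => by rw [hG, Matrix.of_apply]
  have hPD : G.PosDef := pcov_posDef_of_eq hG
  have hGs : ∀ p q, G p q = G q p := fun p q => by
    rw [← hGe, ← hGe]; exact congrArg _ (funext fun ω => mul_comm _ _)
  have hGi : ∀ p q, G⁻¹ p q = G⁻¹ q p := fun p q => by
    have h := hPD.inv.isHermitian.apply q p
    simpa using h
  have hdiag : ∀ p, G p p = 1 := fun p => by rw [← hGe]; exact gksExpect_pair_self (n + 1) (m + 1) K' C' p
  have h2sum := helper_twoSum_precision (n + 1) (m + 1) K' C' hK' hC'card a.castSucc b.castSucc A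
    hab' haA hbA hsides G hG (helper_twoSep_markov (n + 1) (m + 1) K' C' hK' hC'card a.castSucc
      b.castSucc A hab' haA hbA hsides G hG)
  -- the series coupling `K''` and the old structure at that coupling
  obtain ⟨Kpp, hKpp⟩ : ∃ Kpp : ℝ, Kpp = Real.log (Real.cosh (K' i₀.castSucc + K' (Fin.last m))
      / Real.cosh (K' i₀.castSucc - K' (Fin.last m))) / 2 := ⟨_, rfl⟩
  have hKpp0 : 0 ≤ Kpp := by rw [hKpp]; exact spSub_series_nonneg (hK' _) (hK' _)
  obtain ⟨Kv, hKv⟩ : ∃ Kv : Fin m → ℝ, Kv = fun i => if i = i₀ then Kpp else K' i.castSucc :=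
    ⟨_, rfl⟩
  have hKv0 : ∀ i, 0 ≤ Kv i := fun i => by
    rw [hKv]; dsimp only; split_ifs; exacts [hKpp0, hK' _]
  have hmarg : ∀ p q : Fin n, G p.castSucc q.castSucc
      = gksExpect Finset.univ Kv C (fun σ => spinAt p σ * spinAt q σ) := fun p q => by
    rw [← hGe, hKv]
    exact spSub_marginal C i₀ a b hab hCi₀ C' hC'1 hC'2 hC'3 K' Kpp hKpp
      (fun σ => spinAt p σ * spinAt q σ)
  have hAblock : ∀ (p q : Fin n) (hp : p.castSucc ∈ A) (hq : q.castSucc ∈ A),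
      (G.submatrix (Subtype.val : ↥A → Fin (n + 1)) (Subtype.val : ↥A → Fin (n + 1)))⁻¹
          ⟨p.castSucc, hp⟩ ⟨q.castSucc, hq⟩
        = (Matrix.of fun p q : Fin n =>
            gksExpect Finset.univ Kv C (fun ω => spinAt p ω * spinAt q ω))⁻¹ p q := by
    intro p q hp hq
    rw [hKv]
    exact spSub_Ablock C i₀ a b hab hCi₀ C' hC'1 hC'2 hC'3 K' Kpp hKpp G hG p q hp hq
  have hcoupK : ∀ p q : Fin n, ∑ i ∈ Finset.univ.filter (fun i => C i = {p, q}), Kv i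
      = (if ({a, b} : Finset (Fin n)) = {p, q} then Kpp else 0)
        + ∑ i : Fin m, if i ≠ i₀ ∧ C i = {p, q} then K' i.castSucc else 0 := fun p q => by
    rw [hKv]; exact spSub_coupling_Kvec C i₀ a b hCi₀ K' Kpp p q
  have hcoupOld := spSub_coupling_old C i₀ a b C' hC'1 hC'2 hC'3 K'
  -- the bound as a function, and the symmetries
  obtain ⟨bd, hbd⟩ : ∃ bd : Fin (n + 1) → Fin (n + 1) → ℝ, bd = fun x y =>
      -(Real.tanh (∑ i ∈ Finset.univ.filter (fun i => C' i = {x, y}), K' i)) /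
        (1 + Real.tanh (∑ i ∈ Finset.univ.filter (fun i => C' i = {x, y}), K' i) ^ 2
          - 2 * Real.tanh (∑ i ∈ Finset.univ.filter (fun i => C' i = {x, y}), K' i)
            * gksExpect Finset.univ K' C' (fun ω => spinAt x ω * spinAt y ω)) := ⟨_, rfl⟩
  have hbds : ∀ x y, bd x y = bd y x := fun x y => by
    rw [hbd]
    dsimp only
    rw [Finset.pair_comm y x, hGe, hGe y x, hGs]
  suffices key : ∀ x y : Fin (n + 1), x ≠ y →
      (x = Fin.last n ∨ (x ≠ Fin.last n ∧ y ≠ Fin.last n ∧ ¬ (x = b.castSucc ∧ y = a.castSucc))) →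
      G⁻¹ x y ≤ bd x y by
    intro x y hxy
    rw [show -(Real.tanh (∑ i ∈ Finset.univ.filter (fun i => C' i = {x, y}), K' i)) /
        (1 + Real.tanh (∑ i ∈ Finset.univ.filter (fun i => C' i = {x, y}), K' i) ^ 2
          - 2 * Real.tanh (∑ i ∈ Finset.univ.filter (fun i => C' i = {x, y}), K' i)
            * gksExpect Finset.univ K' C' (fun ω => spinAt x ω * spinAt y ω)) = bd x y by rw [hbd]]
    by_cases hx : x = Fin.last n
    · exact key x y hxy (Or.inl hx)
    by_cases hy : y = Fin.last n
    · rw [hGi, hbds]; exact key y x hxy.symm (Or.inl hy)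
    by_cases hba : x = b.castSucc ∧ y = a.castSucc
    · rw [hGi, hbds]
      exact key y x hxy.symm (Or.inr ⟨hy, hx, fun h => hab' (hba.2.symm.trans h.1)⟩)
    · exact key x y hxy (Or.inr ⟨hx, hy, hba⟩)
  intro x y hxy hcase
  rcases hcase with hx | ⟨hx, hy, hnba⟩
  · /- ### `x = ℓ`, the new site -/
    subst hx
    by_cases hya : y = a.castSucc
    · -- degree two at `ℓ`: equality
      subst hya
      have hbond : ∀ j, Fin.last n ∈ C' j →
          (C' j = {Fin.last n, b.castSucc} ∨ C' j = {Fin.last n, a.castSucc}) := by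
        intro j hj
        rcases hcases j with ⟨i, -, -, h⟩ | ⟨-, h⟩ | ⟨-, h⟩
        · exact absurd (h ▸ hj) (spPend_last_not_mem_map (C i))
        · right; rw [h, Finset.pair_comm]
        · left; exact h
      rw [hbd]
      exact le_of_eq (helper_db_deg2_eq (n + 1) (m + 1) K' C' hK' hC'card (Fin.last n) b.castSucc
        a.castSucc hal.symm hbl.symm hab'.symm hbond)
    by_cases hyb : y = b.castSucc
    · subst hyb
      have hbond : ∀ j, Fin.last n ∈ C' j →
          (C' j = {Fin.last n, a.castSucc} ∨ C' j = {Fin.last n, b.castSucc}) := by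
        intro j hj
        rcases hcases j with ⟨i, -, -, h⟩ | ⟨-, h⟩ | ⟨-, h⟩
        · exact absurd (h ▸ hj) (spPend_last_not_mem_map (C i))
        · left; rw [h, Finset.pair_comm]
        · right; exact h
      rw [hbd]
      exact le_of_eq (helper_db_deg2_eq (n + 1) (m + 1) K' C' hK' hC'card (Fin.last n) a.castSucc
        b.castSucc hbl.symm hal.symm hab' hbond)
    · -- a cross entry of the 2-sum: it vanishes, and so does the bound
      have hyB : y ∉ B := fun h => by
        rcases (hmemB y).1 h with h | h | h
        · exact hya h
        · exact hyb h
        · exact hxy h.symm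
      have h0 : G⁻¹ (Fin.last n) y = 0 := by
        rw [h2sum, dif_neg (fun h => hlA h.1), dif_neg (fun h => hyB h.2),
          dif_neg (fun h => hal.symm (((hmemS _).1 h.1).elim id (fun h => absurd h hbl.symm)))]
        ring
      have hS0 : ∑ j ∈ Finset.univ.filter (fun j => C' j = {Fin.last n, y}), K' j = 0 := by
        rw [spSub_coupling_sum C i₀ a b C' hC'1 hC'2 hC'3 K', if_neg, if_neg, add_zero, add_zero]
        · refine Finset.sum_eq_zero (fun i _ => if_neg ?_)
          rintro ⟨-, h⟩
          exact spPend_last_not_mem_map (C i) (by rw [h]; simp)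
        · intro h
          have hm : b.castSucc ∈ ({Fin.last n, y} : Finset (Fin (n + 1))) := by rw [← h]; simp
          simp only [Finset.mem_insert, Finset.mem_singleton] at hm
          rcases hm with hm | hm
          · exact hbl hm
          · exact hyb hm.symm
        · intro h
          have hm : a.castSucc ∈ ({Fin.last n, y} : Finset (Fin (n + 1))) := by rw [← h]; simp
          simp only [Finset.mem_insert, Finset.mem_singleton] at hm
          rcases hm with hm | hm
          · exact hal hm
          · exact hya hm.symm
      rw [hbd]
      dsimp only
      rw [h0, hS0, Real.tanh_zero]
      norm_num
  · /- ### both sites old -/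
    obtain ⟨p, rfl⟩ := Fin.exists_castSucc_eq.2 hx
    obtain ⟨q, rfl⟩ := Fin.exists_castSucc_eq.2 hy
    have hpq : p ≠ q := fun h => hxy (by rw [h])
    have hpA : p.castSucc ∈ A := (hmemA _).2 hx
    have hqA : q.castSucc ∈ A := (hmemA _).2 hy
    by_cases hS : ({p, q} : Finset (Fin n)) = {a, b}
    · rcases spSub_pair_eq_pair hpq hS with ⟨rfl, rfl⟩ | ⟨rfl, rfl⟩
      swap
      · exact absurd ⟨rfl, rfl⟩ hnba
      /- ### THE SEPARATOR PAIR `(a', b')` -/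
      -- total new coupling on `{a', b'}` (the old bonds parallel to `i₀`)
      obtain ⟨K₁, hK₁⟩ : ∃ K₁ : ℝ, (∑ j ∈ Finset.univ.filter
          (fun j => C' j = {p.castSucc, q.castSucc}), K' j) = K₁ := ⟨_, rfl⟩
      have hK₁0 : 0 ≤ K₁ := hK₁ ▸ Finset.sum_nonneg (fun j _ => hK' j)
      -- the bonds inside `B`
      have hBbonds : ∀ j, C' j ⊆ B → C' j = {p.castSucc, q.castSucc} ∨
          C' j = {p.castSucc, Fin.last n} ∨ C' j = {Fin.last n, q.castSucc} :=
        fun j hj => spSub_bond_in_B C hC i₀ p q hab C' hC'1 hC'2 hC'3 j hj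
      have hsidesB : ∀ j, C' j ⊆ B ∨ C' j ⊆ insert p.castSucc (insert q.castSucc Bᶜ) := by
        intro j
        rcases hsides j with h | h
        · right
          intro z hz
          have hzl : z ≠ Fin.last n := (hmemA z).1 (h hz)
          rw [Finset.mem_insert, Finset.mem_insert, Finset.mem_compl, hmemB]
          by_cases h1 : z = p.castSucc
          · exact Or.inl h1
          by_cases h2 : z = q.castSucc
          · exact Or.inr (Or.inl h2)
          exact Or.inr (Or.inr (fun h => h.elim h1 (fun h => h.elim h2 hzl)))
        · exact Or.inl h
      -- the effective coupling `J` of the bonds outside `B`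
      obtain ⟨rA, hrA⟩ : ∃ rA : ℝ, rA = gksExpect (Finset.univ.filter (fun i => ¬ C' i ⊆ B)) K' C'
          (fun ω => spinAt p.castSucc ω * spinAt q.castSucc ω) := ⟨_, rfl⟩
      have hrA0 : 0 ≤ rA := by
        rw [hrA, show (fun ω => spinAt p.castSucc ω * spinAt q.castSucc ω)
            = spinProduct ({p.castSucc, q.castSucc} : Finset (Fin (n + 1))) from
          funext fun ω => (c2_spinProduct_pair hab' ω).symm]
        exact gksExpect_spinProduct_nonneg _ _ _ (fun i _ => hK' i) _
      have hrA1 : rA < 1 := by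
        obtain ⟨h1, -⟩ := marg_corr_lt (Finset.univ.filter (fun i => ¬ C' i ⊆ B)) K' C' hab'
        rw [hrA]
        exact (div_lt_one (gksSum_one_pos _ _ _)).2 h1
      obtain ⟨J, hJ⟩ : ∃ J : ℝ, J = Real.log ((1 + rA) / (1 - rA)) / 2 := ⟨_, rfl⟩
      have hJ0 : 0 ≤ J := hJ ▸ spSub_artanh_nonneg hrA0 hrA1
      -- the triangle system `T`
      obtain ⟨KT, hKT⟩ : ∃ KT : Fin (m + 1) ⊕ Unit → ℝ,
          KT = Sum.elim (fun i => if C' i ⊆ B then K' i else 0) (fun _ => J) := ⟨_, rfl⟩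
      obtain ⟨CT, hCT⟩ : ∃ CT : Fin (m + 1) ⊕ Unit → Finset (Fin (n + 1)),
          CT = Sum.elim (fun i => if C' i ⊆ B then C' i else {Fin.last n, q.castSucc})
            (fun _ => {p.castSucc, q.castSucc}) := ⟨_, rfl⟩
      have hHam : ∀ ω, gksHamiltonian Finset.univ KT
          (Sum.elim C' (fun _ => ({p.castSucc, q.castSucc} : Finset (Fin (n + 1))))) ω
            = gksHamiltonian Finset.univ KT CT ω := by
        intro ω
        rw [hKT, hCT]
        unfold gksHamiltonian
        rw [Fintype.sum_sum_type, Fintype.sum_sum_type]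
        simp only [Sum.elim_inl, Sum.elim_inr]
        congr 1
        refine Finset.sum_congr rfl fun i _ => ?_
        by_cases h : C' i ⊆ B
        · rw [if_pos h, if_pos h]
        · rw [if_neg h, if_neg h, zero_mul, zero_mul]
      -- `helper_marginal_twoSep` (ii): on `B`, `G` is the second-moment matrix of `T`
      have hmargB := (helper_marginal_twoSep (n + 1) (m + 1) K' C' hK' hC'card p.castSucc q.castSucc
        B hab' haB hbB hsidesB).2
      have hlink : ∀ r s, r ∈ B → s ∈ B →
          G r s = gksExpect Finset.univ KT CT (fun ω => spinAt r ω * spinAt s ω) := by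
        intro r s hr hs
        rw [← hGe, hmargB r s hr hs, ← hrA, ← hJ, ← hKT]
        simp only [gksExpect, gksSum, gksWeight, hHam]
      -- the separator correlation `ρ = tanh (K₁ + J + K'')`
      have hrho : G p.castSucc q.castSucc = Real.tanh (K₁ + J + Kpp) := by
        rw [hlink _ _ haB hbB, spSub_T_rho K' C' hab' hal hbl.symm B haB hbB hlB hBbonds J KT hKT
          CT hCT, hK₁, spSub_coupling_al C i₀ p q hab C' hC'1 hC'2 hC'3 K',
          spSub_coupling_lb C i₀ p q hab C' hC'1 hC'2 hC'3 K', ← hKpp]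
      -- `Q`: the `B`-block inverse entry (degree-two equality in `T`)
      have hQ : (G.submatrix (Subtype.val : ↥B → Fin (n + 1)) (Subtype.val : ↥B → Fin (n + 1)))⁻¹
            ⟨p.castSucc, haB⟩ ⟨q.castSucc, hbB⟩
          = -(Real.tanh (K₁ + J)) / (1 + Real.tanh (K₁ + J) ^ 2
              - 2 * Real.tanh (K₁ + J) * G p.castSucc q.castSucc) := by
        obtain ⟨h1, h2⟩ := spSub_T_Q K' C' hK' hab' hal hbl.symm B haB hbB hlB hBbonds J hJ0 KT hKT
          CT hCT
        have hsubB : G.submatrix (Subtype.val : ↥B → Fin (n + 1)) (Subtype.val : ↥B → Fin (n + 1))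
            = (Matrix.of fun r s : Fin (n + 1) =>
                gksExpect Finset.univ KT CT (fun ω => spinAt r ω * spinAt s ω)).submatrix
              (Subtype.val : ↥B → Fin (n + 1)) (Subtype.val : ↥B → Fin (n + 1)) := by
          ext z₁ z₂
          simp only [Matrix.submatrix_apply, Matrix.of_apply]
          exact hlink _ _ z₁.2 z₂.2
        rw [hsubB, ← h1, h2, hK₁, ← hlink _ _ haB hbB]
      -- the `S`-block inverse entry `−ρ/(1 − ρ²)`
      have hρ : 1 - G p.castSucc q.castSucc ^ 2 ≠ 0 := by
        have h := pcov_det_two_pos hPD hab'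
        rw [hdiag, hdiag, hGs q.castSucc p.castSucc] at h
        nlinarith [h]
      have hSblock := spSub_inv_two G hab' (hdiag _) (hdiag _) (hGs _ _) hρ haS hbS
      -- `P`: the old inverse entry at the series coupling, bounded by the hypothesis
      have hP : (G.submatrix (Subtype.val : ↥A → Fin (n + 1)) (Subtype.val : ↥A → Fin (n + 1)))⁻¹
            ⟨p.castSucc, haA⟩ ⟨q.castSucc, hbA⟩
          ≤ -(Real.tanh (K₁ + Kpp)) / (1 + Real.tanh (K₁ + Kpp) ^ 2
              - 2 * Real.tanh (K₁ + J + Kpp) * Real.tanh (K₁ + Kpp)) := by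
        rw [hAblock p q haA hbA]
        have h := IH Kv hKv0 p q hab
        rw [hcoupK p q, if_pos rfl, ← hcoupOld p q, hK₁, ← hmarg p q, hrho, add_comm Kpp K₁] at h
        calc _ ≤ _ := h
          _ = _ := by ring
      have hQ' : (G.submatrix (Subtype.val : ↥B → Fin (n + 1)) (Subtype.val : ↥B → Fin (n + 1)))⁻¹
            ⟨p.castSucc, haB⟩ ⟨q.castSucc, hbB⟩
          ≤ -(Real.tanh (K₁ + J)) / (1 + Real.tanh (K₁ + J) ^ 2
              - 2 * Real.tanh (K₁ + J + Kpp) * Real.tanh (K₁ + J)) := by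
        rw [hQ, hrho]
        exact le_of_eq (by ring)
      have hglue := helper_db_glue_ineq K₁ J Kpp _ _ hK₁0 hJ0 hKpp0 hP hQ'
      -- assembling the 2-sum formula
      have hA' : (if h : p.castSucc ∈ A ∧ q.castSucc ∈ A then
          (G.submatrix (Subtype.val : ↥A → Fin (n + 1)) (Subtype.val : ↥A → Fin (n + 1)))⁻¹
            ⟨p.castSucc, h.1⟩ ⟨q.castSucc, h.2⟩ else 0)
          = (G.submatrix (Subtype.val : ↥A → Fin (n + 1)) (Subtype.val : ↥A → Fin (n + 1)))⁻¹
            ⟨p.castSucc, haA⟩ ⟨q.castSucc, hbA⟩ := by rw [dif_pos ⟨haA, hbA⟩]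
      have hB' : (if h : p.castSucc ∈ B ∧ q.castSucc ∈ B then
          (G.submatrix (Subtype.val : ↥B → Fin (n + 1)) (Subtype.val : ↥B → Fin (n + 1)))⁻¹
            ⟨p.castSucc, h.1⟩ ⟨q.castSucc, h.2⟩ else 0)
          = (G.submatrix (Subtype.val : ↥B → Fin (n + 1)) (Subtype.val : ↥B → Fin (n + 1)))⁻¹
            ⟨p.castSucc, haB⟩ ⟨q.castSucc, hbB⟩ := by rw [dif_pos ⟨haB, hbB⟩]
      have hS' : (if h : p.castSucc ∈ ({p.castSucc, q.castSucc} : Finset (Fin (n + 1))) ∧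
            q.castSucc ∈ ({p.castSucc, q.castSucc} : Finset (Fin (n + 1))) then
          (G.submatrix (Subtype.val : ↥({p.castSucc, q.castSucc} : Finset (Fin (n + 1))) → Fin (n + 1))
              (Subtype.val : ↥({p.castSucc, q.castSucc} : Finset (Fin (n + 1))) → Fin (n + 1)))⁻¹
            ⟨p.castSucc, h.1⟩ ⟨q.castSucc, h.2⟩ else 0)
          = -G p.castSucc q.castSucc / (1 - G p.castSucc q.castSucc ^ 2) := by
        rw [dif_pos ⟨haS, hbS⟩, hSblock]
      rw [hbd]
      dsimp only
      rw [h2sum, hA', hB', hS', hK₁, hGe, hrho]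
      calc _ = _ + _ + Real.tanh (K₁ + J + Kpp) / (1 - Real.tanh (K₁ + J + Kpp) ^ 2) := by ring
        _ ≤ _ := hglue
        _ = _ := by ring
    · /- ### an old pair other than the separator: the old inverse entry -/
      have hpS : p.castSucc ∈ ({a.castSucc, b.castSucc} : Finset (Fin (n + 1))) → (p = a ∨ p = b) :=
        fun h => ((hmemS _).1 h).imp (fun h => Fin.castSucc_injective _ h)
          (fun h => Fin.castSucc_injective _ h)
      have hqS : q.castSucc ∈ ({a.castSucc, b.castSucc} : Finset (Fin (n + 1))) → (q = a ∨ q = b) :=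
        fun h => ((hmemS _).1 h).imp (fun h => Fin.castSucc_injective _ h)
          (fun h => Fin.castSucc_injective _ h)
      have hpB : p.castSucc ∈ B → (p = a ∨ p = b) := fun h => by
        rcases (hmemB _).1 h with h | h | h
        · exact Or.inl (Fin.castSucc_injective _ h)
        · exact Or.inr (Fin.castSucc_injective _ h)
        · exact absurd h hx
      have hqB : q.castSucc ∈ B → (q = a ∨ q = b) := fun h => by
        rcases (hmemB _).1 h with h | h | h
        · exact Or.inl (Fin.castSucc_injective _ h)
        · exact Or.inr (Fin.castSucc_injective _ h)
        · exact absurd h hy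
      have hnotS : ¬ (p.castSucc ∈ ({a.castSucc, b.castSucc} : Finset (Fin (n + 1))) ∧
          q.castSucc ∈ ({a.castSucc, b.castSucc} : Finset (Fin (n + 1)))) :=
        fun h => hS (spSub_pair_of_mem hpq (hpS h.1) (hqS h.2))
      have hnotB : ¬ (p.castSucc ∈ B ∧ q.castSucc ∈ B) :=
        fun h => hS (spSub_pair_of_mem hpq (hpB h.1) (hqB h.2))
      have h := IH Kv hKv0 p q hpq
      rw [hcoupK p q, if_neg (Ne.symm hS), zero_add, ← hcoupOld p q, ← hmarg p q] at h
      rw [hbd]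
      dsimp only
      rw [h2sum, dif_pos ⟨hpA, hqA⟩, dif_neg hnotB, dif_neg hnotS, add_zero, sub_zero,
        hAblock p q hpA hqA, hGe]
      exact h

end

end Summit.CriticalPhenomena.Ising3DConformalLimit.Cruxes.InverseMFerromagnet.PartialCovarianceLadder
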